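import Literature.NumberTheory.K2Lit.DoubledUnitaryDegeneratePrincipalSeries          -- ★ D1 `localSiegelCharacter`, `IsLocalSiegelSection`, `localDegPS`
import Literature.NumberTheory.K2Lit.SiegelDoubledUnipotent                         -- ★ D9 (adelic twin): `fromBlocks_unip_mul`, `fromBlocks_unip_inv`
import Literature.NumberTheory.GelbartRogawski1991.LocalDoubledUnitaryUnramifiedCell   -- ★ local `weylDelta`, `nElem`, `matA`, `adapt`, `ofAdapted`
import Literature.NumberTheory.GelbartRogawski1991.LocalDoubledUnitaryParabolicNorm     -- ★ `det_deltaBlockS_apply`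
import Mathlib.MeasureTheory.Integral.Bochner.Basic
import HarnessLib

/-!
# The local Siegel unipotent radical `N_Δ(F_v)`, the local intertwining integral `M_v(s)` and spherical
# Siegel sections of the doubled unitary group `H(F_v) = U(𝕍 ⊕ −𝕍)(F_v)` (K2Lit leaf D10)

Track B «K2-LIT», crux hLiu418 = `stmt-HodgeConjecture-24832`, road `K2_Liu`, socket #41 `sig_K2LiuSiegelEisensteinContinuation`
(U6), organ O41.5 «Gindikin–Karpelevich for the Siegel parabolic» (LEAD F0P6-plan (g10) DEAL 2026-09-03T23:22:15Z to the steward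
K2Liu-p01 (g2); REPORT-FIRST `K2/K2Liu-p01/g2/REPORT-FIRST-O41_5-GindikinKarpelevich.K2Liup01g2.md` 220813e546421255 §3 file (3)).
DEFINITIONS WITH BODIES + their algebra; no `instance`, no `notation`, no `sorry`.  This is ★ D9 `K2Lit/SiegelDoubledUnipotent`
AT ONE FINITE PLACE, over the local carriers of ★ `GelbartRogawski1991/LocalDoubledUnitary*` (`UnitaryGroup.localPi E c (n+n) JD v`,
the `Δ`-adapted frame `adapt (matA g) = [[A, B], [C, D]]`, `P_Δ = {C = 0}`, the local Weyl element `weylDelta`) and of ★ D1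
`K2Lit/DoubledUnitaryDegeneratePrincipalSeries` (`localSiegelCharacter χ_v s`, `IsLocalSiegelSection`, `IsSmooth`, `localDegPS`).
Namespace shared with ★ D1 (`Literature.NumberTheory.K2Lit.LocalSiegelDoubled`).

CONTENTS.
* §1 `unipDeltaLocal : Subgroup (H(F_v))` — `N_Δ(F_v) = {u : adapt (matA u) = [[1, t], [0, 1]]}`; membership through the adapted blocks
  (`C = 0`, `A = D = 1`), `N_Δ ≤ P_Δ` (`isSiegelDelta_of_mem_unipDeltaLocal`), the elements ★ `nElem t` lie in it, `N_Δ(F_v)` is commutative.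
* §2 on `N_Δ(F_v)`: the `Δ`-block is `1`, `det_Δ = 1` at every `w ∣ v`, `χ_v(det_Δ) = 1`, `|det_Δ|_v = 1`, so the inducing character
  `localSiegelCharacter χ_v s` is trivial and every Siegel section is left-`N_Δ(F_v)`-invariant (`apply_unipDeltaLocal_mul`).
* §3 `localIntertwining νN f h := ∫_{N_Δ(F_v)} f (w_Δ u h) dνN(u)` — the local Siegel intertwining integral `M_v(s)` with the Haar
  measure as a PARAMETER (sockets quantify `νN` with `IsHaarMeasure`; no measure is constructed here, R8).
* §4 `IsSphericalSection χ_v s φ` — a Siegel section, right-invariant under `K_v = H(𝒪_v)` (★ `UnitaryGroup.localInt`), with `φ(1) = 1`;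
  such a `φ` is `1` on `K_v`, equals `localSiegelCharacter χ_v s p` at `p k`, is smooth (so lies in ★ `localDegPS χ_v s`), and is UNIQUE
  as soon as `H(F_v) = P_Δ(F_v) · K_v` (the Iwasawa decomposition is a HYPOTHESIS here; its proof is organ (4) of O41.5).
HONEST LABEL.  Carriers only; `HC_CM` is proved only modulo the 7 printed citations (2 remaining named inputs: hLiu418 = 24832, h413 =
24833) until rung 0 closes.

## References
* [Casselman1980] W. Casselman, *The unramified principal series of p-adic groups I*, Compositio Math. 40 (1980): §3 (the intertwining
  integral `∫_{N_w} φ(w n g) dn`, spherical vectors).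
* [HarrisKudlaSweet1996] M. Harris, S. Kudla, W. J. Sweet, J. Amer. Math. Soc. 9 (1996): §1 (1.11)–(1.16) (`P_Δ = M_Δ N_Δ`, `I_n(s,χ)`),
  §6 (6.14)–(6.16) (the unramified computation of `M(s)`).
* [Kudla1994] S. S. Kudla, Israel J. Math. 87 (1994), §3 (the doubled space, `Δ`, `P_Δ`, `w_Δ`).
* [Tan1999] V. Tan, *Poles of Siegel Eisenstein series on U(n,n)*, Canad. J. Math. 51 (1999): §2 (`M(s) = ⊗_v M_v(s)`).
-/

set_option autoImplicit false

noncomputable section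

open NumberField IsDedekindDomain MeasureTheory Matrix
open Literature.NumberTheory.Automorphic Literature.NumberTheory.Automorphic.UnitaryGroup
open Literature.NumberTheory.GelbartRogawski1991.AdaptedBlocks
open Literature.NumberTheory.GelbartRogawski1991.UnitaryDualPair.LocalSplitting

namespace Literature.NumberTheory.K2Lit.LocalSiegelDoubled

variable (F : Type) [Field F] [NumberField F] (E : Type) [Field E] [NumberField E] [Algebra F E]
  [Algebra.IsQuadraticExtension F E] (c : E ≃ₐ[F] E)
  {δ : E} (hcδ : c δ = -δ) (hδ : δ ≠ 0) {d : F} (hd : δ * δ = algebraMap F E d)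
  (v : HeightOneSpectrum (𝓞 F)) (n : ℕ) {T₀ : Matrix (Fin n) (Fin n) F} (hT₀ : T₀.IsSymm)
  {JD : Matrix (Fin (n + n)) (Fin (n + n)) E} (hJD : JD = (gramD F n T₀).map (algebraMap F E))

/-! ## §1 `N_Δ(F_v)` -/

omit [Algebra.IsQuadraticExtension F E] in
/-- **The unipotent radical `N_Δ(F_v) ≤ H(F_v)` of the local Siegel parabolic**: the elements whose `Δ`-adapted matrix is
`[[1, t], [0, 1]]` (`adapt (matA u)`, ★ `LocalDoubledUnitaryLagrangians.matA`, ★ `AdaptedBlocks.adapt`); the `T₀`-skew `t` are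
exactly the ★ `nElem t` of `LocalDoubledUnitaryUnramifiedCell` (`nElem_mem_unipDeltaLocal`).
[cite: HarrisKudlaSweet1996, §1 (1.11)] [cite: Kudla1994, §3] [cite: Casselman1980, §3] -/
def unipDeltaLocal : Subgroup (UnitaryGroup.localPi E c (n + n) JD v) where
  carrier := {u | ∃ t : Matrix (Fin n) (Fin n) (LocalRing E v), adapt (matA F E c v n u) = Matrix.fromBlocks 1 t 0 1}
  one_mem' := ⟨0, by rw [matA_one, adapt_one, Matrix.fromBlocks_one]⟩
  mul_mem' := by
    rintro p q ⟨t, ht⟩ ⟨t', ht'⟩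
    exact ⟨t' + t, by rw [← matA_mul, adapt_mul, ht, ht', SiegelDoubled.fromBlocks_unip_mul]⟩
  inv_mem' := by
    rintro p ⟨t, ht⟩
    refine ⟨-t, ?_⟩
    have h1 : adapt (matA F E c v n p⁻¹) * adapt (matA F E c v n p) = 1 := by
      rw [← adapt_mul, matA_mul, inv_mul_cancel, matA_one, adapt_one]
    rw [ht] at h1
    rw [← SiegelDoubled.fromBlocks_unip_inv, Matrix.inv_eq_left_inv h1]

omit [Algebra.IsQuadraticExtension F E] in
/-- membership in `N_Δ(F_v)`: `adapt (matA u) = [[1, t], [0, 1]]` for some `t`. [cite: Kudla1994, §3] -/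
theorem mem_unipDeltaLocal_iff (u : UnitaryGroup.localPi E c (n + n) JD v) :
    u ∈ unipDeltaLocal F E c v n (JD := JD) ↔
      ∃ t : Matrix (Fin n) (Fin n) (LocalRing E v), adapt (matA F E c v n u) = Matrix.fromBlocks 1 t 0 1 :=
  Iff.rfl

omit [Algebra.IsQuadraticExtension F E] in
/-- membership in `N_Δ(F_v)` through the adapted blocks: `C = 0`, `A = 1`, `D = 1` (then `t = B`). [cite: Kudla1994, §3] -/
theorem mem_unipDeltaLocal_iff_blocks (u : UnitaryGroup.localPi E c (n + n) JD v) :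
    u ∈ unipDeltaLocal F E c v n (JD := JD) ↔
      blkC (matA F E c v n u) = 0 ∧ blkA (matA F E c v n u) = 1 ∧ blkD (matA F E c v n u) = 1 := by
  rw [mem_unipDeltaLocal_iff]
  constructor
  · rintro ⟨t, ht⟩
    rw [adapt_eq] at ht
    obtain ⟨hA, -, hC, hD⟩ := Matrix.fromBlocks_inj.1 ht
    exact ⟨hC, hA, hD⟩
  · rintro ⟨hC, hA, hD⟩
    exact ⟨blkB (matA F E c v n u), by rw [adapt_eq, hA, hC, hD]⟩

include hcδ hδ hd hT₀ hJD in
/-- **`N_Δ(F_v) ≤ P_Δ(F_v)`** (`C = 0`). [cite: HarrisKudlaSweet1996, §1 (1.11)] -/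
theorem isSiegelDelta_of_mem_unipDeltaLocal {u : UnitaryGroup.localPi E c (n + n) JD v}
    (hu : u ∈ unipDeltaLocal F E c v n (JD := JD)) : IsSiegelDelta F E c hcδ hδ hd v n hT₀ hJD u :=
  (isSiegelDelta_iff_blkC_eq_zero F E c hcδ hδ hd v n hT₀ hJD u).2 ((mem_unipDeltaLocal_iff_blocks F E c v n u).1 hu).1

omit [Algebra.IsQuadraticExtension F E] in
include hJD in
/-- the elements `n(t)` (★ `nElem`, `T₀`-skew `t`) lie in `N_Δ(F_v)`. [cite: Kudla1994, §3] -/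
theorem nElem_mem_unipDeltaLocal (t : Matrix (Fin n) (Fin n) (LocalRing E v))
    (ht : (t.map (conjLocal E c v))ᵀ * gramS F E v n T₀ + gramS F E v n T₀ * t = 0) :
    nElem F E c v n hJD t ht ∈ unipDeltaLocal F E c v n (JD := JD) :=
  ⟨t, adapt_matA_nElem F E c v n hJD t ht⟩

omit [Algebra.IsQuadraticExtension F E] in
/-- **`N_Δ(F_v)` is commutative** (`(1 t; 0 1)(1 t'; 0 1) = (1 (t+t'); 0 1)`; `N_Δ ≅ Herm_n(E_v)` additively).
[cite: HarrisKudlaSweet1996, §1 (1.11)] [cite: Casselman1980, §3] -/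
theorem mul_comm_of_mem_unipDeltaLocal {p q : UnitaryGroup.localPi E c (n + n) JD v}
    (hp : p ∈ unipDeltaLocal F E c v n (JD := JD)) (hq : q ∈ unipDeltaLocal F E c v n (JD := JD)) : p * q = q * p := by
  obtain ⟨t, ht⟩ := hp
  obtain ⟨t', ht'⟩ := hq
  refine matA_injective F E c v n (eq_of_adapt_eq ?_)
  rw [← matA_mul, ← matA_mul, adapt_mul, adapt_mul, ht, ht', SiegelDoubled.fromBlocks_unip_mul, SiegelDoubled.fromBlocks_unip_mul,
    add_comm]

/-! ## §2 `det_Δ = 1` on `N_Δ(F_v)`: the inducing character is trivial, Siegel sections are left-`N_Δ`-invariant -/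

omit [Algebra.IsQuadraticExtension F E] in
/-- on `N_Δ(F_v)` the `Δ`-block `u₁₁ + u₁₂` of the matrix over `E ⊗ F_v` is `1` (`A + C` with `A = 1`, `C = 0`). [cite: Kudla1994, §3] -/
theorem toBlocks_add_eq_one_of_mem_unipDeltaLocal {u : UnitaryGroup.localPi E c (n + n) JD v}
    (hu : u ∈ unipDeltaLocal F E c v n (JD := JD)) :
    (matA F E c v n u).toBlocks₁₁ + (matA F E c v n u).toBlocks₁₂ = 1 := by
  obtain ⟨hC, hA, -⟩ := (mem_unipDeltaLocal_iff_blocks F E c v n u).1 hu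
  rw [← blkA_eq_of_blkC_eq_zero hC, hA]

omit [Algebra.IsQuadraticExtension F E] in
/-- **`det_Δ u_w = 1` at every place `w ∣ v`** for `u ∈ N_Δ(F_v)`. [cite: HarrisKudlaSweet1996, §1 (1.15)] -/
theorem detDelta_eq_one_of_mem_unipDeltaLocal {u : UnitaryGroup.localPi E c (n + n) JD v}
    (hu : u ∈ unipDeltaLocal F E c v n (JD := JD)) (w : PlacesOver E v) : detDelta F E c v n w u = 1 := by
  rw [← det_deltaBlockS_apply F E c v n u w]
  change ((matA F E c v n u).toBlocks₁₁ + (matA F E c v n u).toBlocks₁₂).det w = 1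
  rw [toBlocks_add_eq_one_of_mem_unipDeltaLocal F E c v n hu, Matrix.det_one, Pi.one_apply]

omit [Algebra.IsQuadraticExtension F E] in
/-- `χ_v(det_Δ u) = 1` on `N_Δ(F_v)`. [cite: HarrisKudlaSweet1996, §1 (1.15)] -/
theorem chiDet_eq_one_of_mem_unipDeltaLocal (χv : ∀ w : PlacesOver E v, (w.1.adicCompletion E)ˣ →* ℂˣ)
    {u : UnitaryGroup.localPi E c (n + n) JD v} (hu : u ∈ unipDeltaLocal F E c v n (JD := JD)) :
    chiDet F E c v n χv u = 1 := by
  unfold chiDet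
  refine Finset.prod_eq_one fun w _ => ?_
  have hd := detDelta_eq_one_of_mem_unipDeltaLocal F E c v n hu w
  have hunit : IsUnit (detDelta F E c v n w u) := by rw [hd]; exact isUnit_one
  have h1 : hunit.unit = 1 := Units.ext (by rw [IsUnit.unit_spec, hd, Units.val_one])
  rw [dif_pos hunit, h1, map_one]

omit [Algebra.IsQuadraticExtension F E] in
/-- `|det_Δ u|_v = 1` on `N_Δ(F_v)`. [cite: HarrisKudlaSweet1996, §1 (1.15)] -/
theorem absDetDelta_eq_one_of_mem_unipDeltaLocal {u : UnitaryGroup.localPi E c (n + n) JD v}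
    (hu : u ∈ unipDeltaLocal F E c v n (JD := JD)) : absDetDelta F E c v n u = 1 := by
  unfold absDetDelta
  exact Finset.prod_eq_one fun w _ => by rw [detDelta_eq_one_of_mem_unipDeltaLocal F E c v n hu w, norm_one]

omit [Algebra.IsQuadraticExtension F E] in
/-- **The inducing character `χ_v(det_Δ ·)|det_Δ ·|_v^{s+n/2}` is trivial on `N_Δ(F_v)`.** [cite: HarrisKudlaSweet1996, §1 (1.15)] [cite: Casselman1980, §3] -/
theorem localSiegelCharacter_eq_one_of_mem_unipDeltaLocal (χv : ∀ w : PlacesOver E v, (w.1.adicCompletion E)ˣ →* ℂˣ) (s : ℂ)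
    {u : UnitaryGroup.localPi E c (n + n) JD v} (hu : u ∈ unipDeltaLocal F E c v n (JD := JD)) :
    localSiegelCharacter F E c v n χv s u = 1 := by
  unfold localSiegelCharacter
  rw [chiDet_eq_one_of_mem_unipDeltaLocal F E c v n χv hu, absDetDelta_eq_one_of_mem_unipDeltaLocal F E c v n hu, Units.val_one,
    Complex.ofReal_one, Complex.one_cpow, mul_one]

variable {F E c hcδ hδ hd v n hT₀ hJD} in
/-- **Siegel sections are left-`N_Δ(F_v)`-invariant**: `f(u h) = f(h)` for `u ∈ N_Δ(F_v)`, `f ∈ I_v(s, χ_v)`.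
[cite: HarrisKudlaSweet1996, §1 (1.15)] [cite: Casselman1980, §3] -/
theorem apply_unipDeltaLocal_mul {χv : ∀ w : PlacesOver E v, (w.1.adicCompletion E)ˣ →* ℂˣ} {s : ℂ}
    {f : UnitaryGroup.localPi E c (n + n) JD v → ℂ} (hf : IsLocalSiegelSection F E c hcδ hδ hd v n hT₀ hJD χv s f)
    {u : UnitaryGroup.localPi E c (n + n) JD v} (hu : u ∈ unipDeltaLocal F E c v n (JD := JD))
    (h : UnitaryGroup.localPi E c (n + n) JD v) : f (u * h) = f h := by
  rw [hf u (isSiegelDelta_of_mem_unipDeltaLocal F E c hcδ hδ hd v n hT₀ hJD hu) h,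
    localSiegelCharacter_eq_one_of_mem_unipDeltaLocal F E c v n χv s hu, one_mul]

/-! ## §3 The local Siegel intertwining integral `M_v(s)` -/

omit [Algebra.IsQuadraticExtension F E] in
include hJD in
/-- **The local Siegel intertwining integral** `M_v f (h) = ∫_{N_Δ(F_v)} f (w_Δ u h) dνN(u)` (★ local `weylDelta`; the Haar measure
`νN` on `N_Δ(F_v)` is a PARAMETER; junk `0` when the integrand is not integrable).  For `f = φ°_s` spherical in `I_v(s,χ_v)`, `χ_v`
unramified and `Re s > (n−1)/2` this is `νN(N_Δ(𝒪_v)) · (a_v/b_v)(s) · φ°_{−s}` (Gindikin–Karpelevich, organ O41.5 — NOT proved here).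
[cite: Casselman1980, §3] [cite: HarrisKudlaSweet1996, §6 (6.14)–(6.16)] [cite: Tan1999, §2] -/
def localIntertwining [MeasurableSpace (unipDeltaLocal F E c v n (JD := JD))] (νN : Measure (unipDeltaLocal F E c v n (JD := JD)))
    (f : UnitaryGroup.localPi E c (n + n) JD v → ℂ) (h : UnitaryGroup.localPi E c (n + n) JD v) : ℂ :=
  ∫ u, f (weylDelta F E c v n hJD * (u : UnitaryGroup.localPi E c (n + n) JD v) * h) ∂νN

omit [Algebra.IsQuadraticExtension F E] in
include hJD in
/-- The intertwining integral of the zero function vanishes. [cite: Casselman1980, §3] -/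
theorem localIntertwining_zero [MeasurableSpace (unipDeltaLocal F E c v n (JD := JD))]
    (νN : Measure (unipDeltaLocal F E c v n (JD := JD))) (h : UnitaryGroup.localPi E c (n + n) JD v) :
    localIntertwining F E c v n hJD νN (fun _ => 0) h = 0 := by
  simp [localIntertwining]

omit [Algebra.IsQuadraticExtension F E] in
include hJD in
/-- The intertwining integral is linear in `f` under integrability: `M_v (a • f + g) = a • M_v f + M_v g`. [cite: Casselman1980, §3] -/
theorem localIntertwining_smul_add [MeasurableSpace (unipDeltaLocal F E c v n (JD := JD))]
    (νN : Measure (unipDeltaLocal F E c v n (JD := JD))) (a : ℂ) (f g : UnitaryGroup.localPi E c (n + n) JD v → ℂ)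
    (h : UnitaryGroup.localPi E c (n + n) JD v)
    (hf : Integrable (fun u : unipDeltaLocal F E c v n (JD := JD) =>
      f (weylDelta F E c v n hJD * (u : UnitaryGroup.localPi E c (n + n) JD v) * h)) νN)
    (hg : Integrable (fun u : unipDeltaLocal F E c v n (JD := JD) =>
      g (weylDelta F E c v n hJD * (u : UnitaryGroup.localPi E c (n + n) JD v) * h)) νN) :
    localIntertwining F E c v n hJD νN (a • f + g) h = a * localIntertwining F E c v n hJD νN f h + localIntertwining F E c v n hJD νN g h := by
  simp only [localIntertwining, Pi.add_apply, Pi.smul_apply, smul_eq_mul]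
  rw [integral_add (hf.const_mul a) hg, integral_const_mul]

/-! ## §4 Spherical Siegel sections -/

/-- **A spherical section of `I_v(s, χ_v)`**: a Siegel section, right-invariant under `K_v = H(𝒪_v)` (★ `UnitaryGroup.localInt`), normalised
by `φ(1) = 1`.  For `χ_v` unramified and `v` good it exists and is unique (`φ°_s(p k) = localSiegelCharacter χ_v s p` through the Iwasawa
decomposition `H(F_v) = P_Δ(F_v) K_v` — uniqueness below, existence is organ (4) of O41.5). [cite: Casselman1980, §3] [cite: HarrisKudlaSweet1996, §6 (6.14)] -/
def IsSphericalSection (χv : ∀ w : PlacesOver E v, (w.1.adicCompletion E)ˣ →* ℂˣ) (s : ℂ)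
    (φ : UnitaryGroup.localPi E c (n + n) JD v → ℂ) : Prop :=
  IsLocalSiegelSection F E c hcδ hδ hd v n hT₀ hJD χv s φ ∧
    (∀ k ∈ UnitaryGroup.localInt E c (n + n) JD v, ∀ h : UnitaryGroup.localPi E c (n + n) JD v, φ (h * k) = φ h) ∧ φ 1 = 1

namespace IsSphericalSection

variable {F E c hcδ hδ hd v n hT₀ hJD}
variable {χv : ∀ w : PlacesOver E v, (w.1.adicCompletion E)ˣ →* ℂˣ} {s : ℂ} {φ : UnitaryGroup.localPi E c (n + n) JD v → ℂ}

/-- a spherical section is a Siegel section. [cite: Casselman1980, §3] -/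
theorem isLocalSiegelSection (hφ : IsSphericalSection F E c hcδ hδ hd v n hT₀ hJD χv s φ) :
    IsLocalSiegelSection F E c hcδ hδ hd v n hT₀ hJD χv s φ :=
  hφ.1

/-- a spherical section is right-`K_v`-invariant. [cite: Casselman1980, §3] -/
theorem apply_mul_of_mem_localInt (hφ : IsSphericalSection F E c hcδ hδ hd v n hT₀ hJD χv s φ)
    {k : UnitaryGroup.localPi E c (n + n) JD v} (hk : k ∈ UnitaryGroup.localInt E c (n + n) JD v)
    (h : UnitaryGroup.localPi E c (n + n) JD v) : φ (h * k) = φ h :=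
  hφ.2.1 k hk h

/-- `φ(1) = 1`. [cite: Casselman1980, §3] -/
theorem apply_one (hφ : IsSphericalSection F E c hcδ hδ hd v n hT₀ hJD χv s φ) : φ 1 = 1 :=
  hφ.2.2

/-- **a spherical section is `1` on `K_v`.** [cite: Casselman1980, §3] -/
theorem apply_of_mem_localInt (hφ : IsSphericalSection F E c hcδ hδ hd v n hT₀ hJD χv s φ)
    {k : UnitaryGroup.localPi E c (n + n) JD v} (hk : k ∈ UnitaryGroup.localInt E c (n + n) JD v) : φ k = 1 := by
  rw [← one_mul k, hφ.apply_mul_of_mem_localInt hk, hφ.apply_one]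

/-- **`φ(p k) = χ_v(det_Δ p)|det_Δ p|_v^{s+n/2}`** for `p ∈ P_Δ(F_v)`, `k ∈ K_v`. [cite: Casselman1980, §3] [cite: HarrisKudlaSweet1996, §6 (6.14)] -/
theorem apply_siegel_mul_localInt (hφ : IsSphericalSection F E c hcδ hδ hd v n hT₀ hJD χv s φ)
    {p k : UnitaryGroup.localPi E c (n + n) JD v} (hp : IsSiegelDelta F E c hcδ hδ hd v n hT₀ hJD p)
    (hk : k ∈ UnitaryGroup.localInt E c (n + n) JD v) : φ (p * k) = localSiegelCharacter F E c v n χv s p := by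
  rw [hφ.1 p hp k, hφ.apply_of_mem_localInt hk, mul_one]

/-- a spherical section is smooth (right-invariant under the OPEN subgroup `K_v`). [cite: HarrisKudlaSweet1996, §1 (1.15)] -/
theorem isSmooth (hφ : IsSphericalSection F E c hcδ hδ hd v n hT₀ hJD χv s φ) : IsSmooth F E c v n φ :=
  ⟨⟨UnitaryGroup.localInt E c (n + n) JD v, UnitaryGroup.isOpen_localInt E c (n + n) JD v⟩, fun h _ hu => hφ.apply_mul_of_mem_localInt hu h⟩

/-- **a spherical section lies in `I_v(s, χ_v)`** (★ `localDegPS`). [cite: HarrisKudlaSweet1996, §1 (1.15)] -/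
theorem mem_localDegPS (hφ : IsSphericalSection F E c hcδ hδ hd v n hT₀ hJD χv s φ) :
    φ ∈ localDegPS F E c hcδ hδ hd v n hT₀ hJD χv s :=
  ⟨hφ.1, hφ.isSmooth⟩

/-- **uniqueness of the spherical section given the Iwasawa decomposition `H(F_v) = P_Δ(F_v) K_v`** (a hypothesis here).
[cite: Casselman1980, §3] -/
theorem unique (hIw : ∀ h : UnitaryGroup.localPi E c (n + n) JD v, ∃ p k : UnitaryGroup.localPi E c (n + n) JD v,
      IsSiegelDelta F E c hcδ hδ hd v n hT₀ hJD p ∧ k ∈ UnitaryGroup.localInt E c (n + n) JD v ∧ h = p * k)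
    {φ' : UnitaryGroup.localPi E c (n + n) JD v → ℂ}
    (hφ : IsSphericalSection F E c hcδ hδ hd v n hT₀ hJD χv s φ) (hφ' : IsSphericalSection F E c hcδ hδ hd v n hT₀ hJD χv s φ') :
    φ = φ' := by
  funext h
  obtain ⟨p, k, hp, hk, rfl⟩ := hIw h
  rw [hφ.apply_siegel_mul_localInt hp hk, hφ'.apply_siegel_mul_localInt hp hk]

end IsSphericalSection

/-- a spherical section is left-`N_Δ(F_v)`-invariant (as every Siegel section). [cite: Casselman1980, §3] -/
theorem IsSphericalSection.apply_unipDeltaLocal_mul {χv : ∀ w : PlacesOver E v, (w.1.adicCompletion E)ˣ →* ℂˣ} {s : ℂ}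
    {φ : UnitaryGroup.localPi E c (n + n) JD v → ℂ} (hφ : IsSphericalSection F E c hcδ hδ hd v n hT₀ hJD χv s φ)
    {u : UnitaryGroup.localPi E c (n + n) JD v} (hu : u ∈ unipDeltaLocal F E c v n (JD := JD))
    (h : UnitaryGroup.localPi E c (n + n) JD v) : φ (u * h) = φ h :=
  Literature.NumberTheory.K2Lit.LocalSiegelDoubled.apply_unipDeltaLocal_mul hφ.1 hu h

end Literature.NumberTheory.K2Lit.LocalSiegelDoubled

end
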